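import Literature.Computability.Complexity.NumProgramsArith
import Literature.Computability.Complexity.NegacyclicFFT
import HarnessLib

/-!
# Numeric register programs, IV: polynomial products over `ℤ/N` through a multiplier opcode

Literature / complexity toolkit, continuing `NumProgramsArith.lean` (program logic of `NCom`)
and `StackNegacyclic.lean` / `NegacyclicFFT.lean` (coefficient vectors `listPoly N v`, the
negacyclic product `negMul N L f g` and its correctness in `(ℤ/N)[x]/(x^L + 1)`).  Harvey's
factoring algorithm (Harvey 2021, §2.2) does all its polynomial arithmetic through one
primitive, the product in `ℤ_N[x]` (Lemma 2.1, `M_N(d) = O(d lg² N)`); the verified fast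
multiplier is a separate machine (the Schönhage–Strassen unit `NegacyclicFFT*.lean`,
`StackFFT*.lean`).  This file fixes the *interface* between the two and builds the first
client on top of it:

* `NCom.MulArgs`, **`NCom.negMulSem cost`** — the abstract meaning of a negacyclic-product
  opcode: `h := negMul N L f g` (the canonical reduced product, whatever algorithm computes
  it), `f, g` kept, `steps += cost L + 1`, `peak` raised by the largest entry; and
  **`NCom.MulPre`** — the standing precondition offered to the brick (`N` odd, `1 < N`, `L` a
  power of two, `|f| = |g| = L`, entries reduced, the three queues distinct).  A multiplier is
  plugged in by giving an extension `𝓔`, an opcode constructor `mulOp`, a monotone `cost`, and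
  the two fields `sem_eq` (the opcode means `negMulSem cost`) and `pre_of` (the brick's
  precondition follows from `MulPre`) — `structure NCom.Multiplier`;
* the algebra of padding: **`negMul_pad`** — for `|A| + |B| - 1 ≤ L`, the negacyclic product
  of the zero-padded operands is the plain product `mulCoeffs N A B` padded with zeros
  (`listPoly` injectivity on reduced vectors, `NegFFT.eq_of_mk_eq`);
* `NCom.pmulP` — plain multiplication in `ℤ_N[x]`: pad both operands to the least power of
  two `L ≥ |A| + |B| - 1`, call the opcode, keep the first `|A| + |B| - 1` coefficients;
  **`NCom.pmulP_spec`** (result `mulCoeffs N A B`, frame, `peak`, `steps ≤ c (|A|+|B|) +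
  cost L + c` with `L < 2 (|A| + |B|)`) and **`NCom.pmulP_extOK`**.

## References

* D. Harvey, *An exponent one-fifth algorithm for deterministic integer factorisation*, Math.
  Comp. 90 (2021), §2.2, Lemma 2.1 (arXiv Lemma 2: products in `ℤ_N[x]`) [Harvey2021].
* J. von zur Gathen, J. Gerhard, *Modern Computer Algebra*, 3rd ed., CUP 2013, §8.3 (products
  modulo `x^n + 1` of zero-padded operands are plain products) [GathenGerhard2013].
-/

namespace Literature.Computability.Complexity

open _root_.Computability Polynomial

/-! ### Coefficient vectors: injectivity, plain products -/

section ListPoly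

variable {N : ℕ}

/-- Reduced coefficient vectors of equal length with the same polynomial are equal.
[folklore] -/
theorem listPoly_injective {u v : List ℕ} (hl : u.length = v.length) (hu : ∀ a ∈ u, a < N)
    (hv : ∀ b ∈ v, b < N) (h : listPoly N u = listPoly N v) : u = v := by
  refine List.ext_getElem hl fun i h₁ h₂ => ?_
  have hc := congr_arg (fun p => p.coeff i) h
  simp only [coeff_listPoly, List.getD_eq_getElem _ _ h₁, List.getD_eq_getElem _ _ h₂] at hc
  have := congr_arg ZMod.val hc
  rwa [ZMod.val_cast_of_lt (hu _ (List.getElem_mem h₁)), ZMod.val_cast_of_lt (hv _ (List.getElem_mem h₂))] at this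

/-- The coefficient vector of length `s` of a polynomial, as residues. [folklore] -/
noncomputable def coeffList (N s : ℕ) (p : (ZMod N)[X]) : List ℕ := (List.range s).map fun k => (p.coeff k).val

/-- Length of `coeffList`. [folklore] -/
@[simp] theorem length_coeffList (N s : ℕ) (p : (ZMod N)[X]) : (coeffList N s p).length = s := by
  simp [coeffList]

/-- Entries of `coeffList` are reduced. [folklore] -/
theorem lt_of_mem_coeffList (hN : 1 < N) {s : ℕ} {p : (ZMod N)[X]} {a : ℕ} (ha : a ∈ coeffList N s p) : a < N := by
  haveI : NeZero N := ⟨(Nat.lt_trans Nat.zero_lt_one hN).ne'⟩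
  simp only [coeffList, List.mem_map, List.mem_range] at ha
  obtain ⟨k, -, rfl⟩ := ha
  exact ZMod.val_lt _

/-- `coeffList` codes the polynomial if `s` exceeds the degree. [folklore] -/
theorem listPoly_coeffList (hN : 1 < N) {s : ℕ} {p : (ZMod N)[X]} (hp : p.degree < s) :
    listPoly N (coeffList N s p) = p := by
  haveI : NeZero N := ⟨(Nat.lt_trans Nat.zero_lt_one hN).ne'⟩
  ext k
  rw [coeff_listPoly]
  by_cases hk : k < s
  · rw [List.getD_eq_getElem _ _ (by simpa using hk)]
    simp [coeffList]
  · rw [List.getD_eq_default _ _ (by simp; omega), Nat.cast_zero]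
    symm
    apply Polynomial.coeff_eq_zero_of_degree_lt
    exact hp.trans_le (by exact_mod_cast not_lt.1 hk)

/-- **The plain product** of two coefficient vectors over `ℤ/N`, of length `|A| + |B| - 1`.
[Harvey 2021, §2.2] [folklore] -/
noncomputable def mulCoeffs (N : ℕ) (A B : List ℕ) : List ℕ :=
  coeffList N (A.length + B.length - 1) (listPoly N A * listPoly N B)

/-- Length of the plain product. [folklore] -/
@[simp] theorem length_mulCoeffs (N : ℕ) (A B : List ℕ) : (mulCoeffs N A B).length = A.length + B.length - 1 :=
  length_coeffList _ _ _

/-- Entries of the plain product are reduced. [folklore] -/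
theorem lt_of_mem_mulCoeffs (hN : 1 < N) {A B : List ℕ} {a : ℕ} (ha : a ∈ mulCoeffs N A B) : a < N :=
  lt_of_mem_coeffList hN ha

/-- The degree of a product of coefficient vectors. [folklore] -/
theorem degree_listPoly_mul_lt (N : ℕ) {A B : List ℕ} (hA : 0 < A.length) (hB : 0 < B.length) :
    (listPoly N A * listPoly N B).degree < (A.length + B.length - 1 : ℕ) := by
  rcases eq_or_ne (listPoly N A * listPoly N B) 0 with h0 | h0
  · rw [h0, Polynomial.degree_zero]; exact WithBot.bot_lt_coe _
  have hA0 : listPoly N A ≠ 0 := left_ne_zero_of_mul h0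
  have hB0 : listPoly N B ≠ 0 := right_ne_zero_of_mul h0
  have h1 : (listPoly N A).natDegree < A.length := (Polynomial.natDegree_lt_iff_degree_lt hA0).2 (degree_listPoly_lt N A)
  have h2 : (listPoly N B).natDegree < B.length := (Polynomial.natDegree_lt_iff_degree_lt hB0).2 (degree_listPoly_lt N B)
  rw [Polynomial.degree_eq_natDegree h0, Nat.cast_lt]
  exact Polynomial.natDegree_mul_le.trans_lt (by omega)

/-- The plain product codes the product polynomial. [folklore] -/
theorem listPoly_mulCoeffs (hN : 1 < N) {A B : List ℕ} (hA : 0 < A.length) (hB : 0 < B.length) :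
    listPoly N (mulCoeffs N A B) = listPoly N A * listPoly N B :=
  listPoly_coeffList hN (degree_listPoly_mul_lt N hA hB)

/-- **Zero-padded negacyclic products are plain products.**  For nonempty `A, B` with reduced
entries and `|A| + |B| - 1 ≤ L`, the negacyclic product of length `L` of the zero-padded
operands is `mulCoeffs N A B` followed by zeros. [von zur Gathen–Gerhard 2013, §8.3] [folklore] -/
theorem negMul_pad (hN : 1 < N) {A B : List ℕ} {L : ℕ} (hA : 0 < A.length) (hB : 0 < B.length)
    (hBN : ∀ b ∈ B, b < N) (hL : A.length + B.length - 1 ≤ L) :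
    negMul N L (A ++ List.replicate (L - A.length) 0) (B ++ List.replicate (L - B.length) 0) =
      mulCoeffs N A B ++ List.replicate (L - (A.length + B.length - 1)) 0 := by
  set F := A ++ List.replicate (L - A.length) 0 with hF
  set G := B ++ List.replicate (L - B.length) 0 with hG
  have hFL : F.length = L := by simp [hF]; omega
  have hGL : G.length = L := by simp [hG]; omega
  have hGN : ∀ b ∈ G, b < N := by
    intro b hb; simp only [hG, List.mem_append, List.mem_replicate] at hb
    rcases hb with hb | ⟨-, rfl⟩; exacts [hBN b hb, by omega]
  have hN0 : 0 < N := by omega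
  -- both sides are reduced vectors of length `L`
  apply listPoly_injective
  · rw [length_negMul _ hGL, List.length_append, length_mulCoeffs, List.length_replicate]; omega
  · exact fun a ha => lt_of_mem_negMul hN0 _ _ ha
  · intro b hb
    rcases List.mem_append.1 hb with hb | hb
    · exact lt_of_mem_mulCoeffs hN hb
    · rw [(List.mem_replicate.1 hb).2]; exact hN0
  -- and code the same element of `(ℤ/N)[x]/(x^L+1)`, both of degree `< L`
  rw [NegFFT.listPoly_append_replicate_zero, listPoly_mulCoeffs hN hA hB]
  apply NegFFT.eq_of_mk_eq hN
  · rw [mk_listPoly_negMul N L (by omega) hGL hGN, hF, hG, NegFFT.listPoly_append_replicate_zero,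
      NegFFT.listPoly_append_replicate_zero, map_mul]
  · exact (degree_listPoly_lt N _).trans_le (by rw [length_negMul _ hGL])
  · exact (degree_listPoly_mul_lt N hA hB).trans_le (by exact_mod_cast hL)

end ListPoly

namespace NCom

variable {S V O X E : Type} [DecidableEq S] [DecidableEq V] [DecidableEq O]

/-! ### The multiplier opcode interface -/

/-- The arguments of a negacyclic-product call: operand queues `f, g`, result queue `h`, and
the scalars holding the modulus `N` and the length `L`. [folklore] -/
structure MulArgs (S V : Type) where
  /-- first operand -/ f : V
  /-- second operand -/ g : V
  /-- result -/ h : V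
  /-- the modulus register -/ n : S
  /-- the length register -/ l : S

/-- **The meaning of a multiplier opcode**: `h := negMul N L f g`, `f, g` kept,
`steps += cost L + 1`, `peak` raised by the largest entry of the result. [folklore] -/
def negMulSem (cost : ℕ → ℕ) (a : MulArgs S V) (σ : NState S V O) : NState S V O :=
  (σ.setVi a.h (negMul (σ.sc a.n) (σ.sc a.l) (σ.vi a.f) (σ.vi a.g))).bump
    ((negMul (σ.sc a.n) (σ.sc a.l) (σ.vi a.f) (σ.vi a.g)).foldr max 0) (cost (σ.sc a.l) + 1)

/-- **The standing precondition of a multiplier call**: odd modulus `N > 1`, length `L` a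
power of two, both operands of length exactly `L` with reduced entries, distinct queues.
[folklore] -/
def MulPre (a : MulArgs S V) (σ : NState S V O) : Prop :=
  Odd (σ.sc a.n) ∧ 1 < σ.sc a.n ∧ (∃ k, σ.sc a.l = 2 ^ k) ∧ (σ.vi a.f).length = σ.sc a.l ∧
    (σ.vi a.g).length = σ.sc a.l ∧ (∀ x ∈ σ.vi a.f, x < σ.sc a.n) ∧ (∀ x ∈ σ.vi a.g, x < σ.sc a.n) ∧
    a.f ≠ a.h ∧ a.g ≠ a.h ∧ a.f ≠ a.g

/-- **A multiplier plugged into the extension `𝓔`**: an opcode constructor whose meaning is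
`negMulSem cost` and whose precondition follows from `MulPre`. [folklore] -/
structure Multiplier (𝓔 : NExt S V O X E) where
  /-- the opcode of a call -/ mulOp : MulArgs S V → E
  /-- its abstract cost as a function of the length -/ cost : ℕ → ℕ
  /-- the cost is monotone in the length -/ cost_mono : Monotone cost
  /-- the opcode means the canonical product -/ sem_eq : ∀ a σ, 𝓔.sem (mulOp a) σ = negMulSem cost a σ
  /-- the brick's precondition follows from the standing one -/ pre_of : ∀ a σ, MulPre a σ → 𝓔.pre (mulOp a) σ

omit [DecidableEq S] [DecidableEq O] in
/-- An entry of a list is at most its maximum. [folklore] -/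
theorem le_foldr_max {l : List ℕ} {x : ℕ} (hx : x ∈ l) : x ≤ l.foldr max 0 := by
  induction l with
  | nil => cases hx
  | cons a l ih =>
    rw [List.foldr_cons]
    rcases List.mem_cons.1 hx with rfl | hx
    · exact le_max_left _ _
    · exact (ih hx).trans (le_max_right _ _)

omit [DecidableEq S] [DecidableEq O] in
/-- The maximum of a list bounded by `b` is at most `b`. [folklore] -/
theorem foldr_max_le {l : List ℕ} {b : ℕ} (h : ∀ x ∈ l, x ≤ b) : l.foldr max 0 ≤ b := by
  induction l with
  | nil => exact Nat.zero_le _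
  | cons a l ih => rw [List.foldr_cons]; exact max_le (h a (by simp)) (ih fun x hx => h x (by simp [hx]))

/-! ### Plain multiplication through the opcode -/

/-- Scalar roles of `pmulP`: the modulus `n`, the operand lengths `la, lb`, the result length
`s`, the padded length `L`, a loop count `t`, the transfer scalar `x`, a counter `cnt`, the
constant `one`. [folklore] -/
inductive PMulS where
  | n | la | lb | s | L | t | x | cnt | one
  deriving DecidableEq, Fintype, Repr

/-- Queue roles of `pmulP`: operands `A, B`, padded operands `F, G`, raw product `H`, result
`C`. [folklore] -/
inductive PMulV where
  | A | B | F | G | H | C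
  deriving DecidableEq, Fintype, Repr

section PMul

variable {𝓔 : NExt S V O X E} (M : Multiplier 𝓔) (ρ : PMulS ↪ S) (ν : PMulV ↪ V) (acc : O)

/-- The preparation of `pmulP`: lengths, the padded length, the padded operands. [folklore] -/
def pmulPre : NCom S V O E :=
  setc (ρ .one) 1 ;ₙ add (ρ .s) (ρ .la) (ρ .lb) ;ₙ sub (ρ .s) (ρ .s) (ρ .one) ;ₙ
  setc (ρ .L) 1 ;ₙ sizeOf (ρ .t) (ρ .s) ;ₙ times (ρ .t) (dblBody (ρ .L) (ρ .s)) ;ₙ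
  moveN (ν .A) acc (ρ .x) (ρ .la) ;ₙ sub (ρ .cnt) (ρ .L) (ρ .la) ;ₙ setc (ρ .x) 0 ;ₙ emitK acc (ρ .x) (ρ .cnt) ;ₙ
  pour acc (ν .F) ;ₙ
  moveN (ν .B) acc (ρ .x) (ρ .lb) ;ₙ sub (ρ .cnt) (ρ .L) (ρ .lb) ;ₙ setc (ρ .x) 0 ;ₙ emitK acc (ρ .x) (ρ .cnt) ;ₙ
  pour acc (ν .G)

/-- The finish of `pmulP`: keep the first `s` coefficients, clean up. [folklore] -/
def pmulPost : NCom S V O E :=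
  moveN (ν .H) acc (ρ .x) (ρ .s) ;ₙ pour acc (ν .C) ;ₙ clearV (ν .H) ;ₙ clearV (ν .F) ;ₙ clearV (ν .G)

/-- **Plain multiplication in `ℤ_N[x]`** through the multiplier opcode: `C := A · B` (as the
coefficient vector `mulCoeffs N A B`), operands consumed. [Harvey 2021, §2.2, Lemma 2.1]
[folklore] -/
def pmulP : NCom S V O E :=
  pmulPre ρ ν acc ;ₙ (ext (M.mulOp ⟨ν .F, ν .G, ν .H, ρ .n, ρ .L⟩) ;ₙ pmulPost ρ ν acc)

omit [DecidableEq S] [DecidableEq V] [DecidableEq O] in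
/-- `pmulPre`/`pmulPost` have no extension calls. [folklore] -/
theorem pmulPre_noExt : (pmulPre ρ ν acc : NCom S V O E).noExt ∧ (pmulPost ρ ν acc : NCom S V O E).noExt := by
  simp [pmulPre, pmulPost, dblBody, noExt, moveN_noExt, emitK_noExt]

/-- **The preparation**: after `pmulPre`, `F` and `G` hold the operands padded with zeros to
a power of two `L` with `|A| + |B| - 1 ≤ L < 2 (|A| + |B| - 1)`, `A, B` are consumed, the other
queues and all accumulators are as before. [folklore] -/
theorem pmulPre_facts (σ : NState S V O) (hla : σ.sc (ρ .la) = (σ.vi (ν .A)).length) (hlb : σ.sc (ρ .lb) = (σ.vi (ν .B)).length)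
    (ha : 0 < (σ.vi (ν .A)).length) (hb : 0 < (σ.vi (ν .B)).length)
    (hF : σ.vi (ν .F) = []) (hG : σ.vi (ν .G) = []) (hacc : σ.vo acc = []) :
    let τ := (pmulPre ρ ν acc : NCom S V O E).eval 𝓔 σ
    ∃ L : ℕ, (∃ k, L = 2 ^ k) ∧ σ.sc (ρ .la) + σ.sc (ρ .lb) - 1 ≤ L ∧ L < 2 * (σ.sc (ρ .la) + σ.sc (ρ .lb) - 1) ∧
      τ.sc (ρ .L) = L ∧ τ.sc (ρ .s) = σ.sc (ρ .la) + σ.sc (ρ .lb) - 1 ∧ τ.sc (ρ .n) = σ.sc (ρ .n) ∧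
      τ.sc (ρ .la) = σ.sc (ρ .la) ∧ τ.sc (ρ .lb) = σ.sc (ρ .lb) ∧ (∀ r, (∀ i, r ≠ ρ i) → τ.sc r = σ.sc r) ∧
      τ.vi (ν .F) = σ.vi (ν .A) ++ List.replicate (L - (σ.vi (ν .A)).length) 0 ∧
      τ.vi (ν .G) = σ.vi (ν .B) ++ List.replicate (L - (σ.vi (ν .B)).length) 0 ∧
      τ.vi (ν .A) = [] ∧ τ.vi (ν .B) = [] ∧ τ.vi (ν .H) = σ.vi (ν .H) ∧ τ.vi (ν .C) = σ.vi (ν .C) ∧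
      (∀ w, (∀ i, w ≠ ν i) → τ.vi w = σ.vi w) ∧ τ.vo = σ.vo ∧
      τ.peak ≤ max σ.peak (2 * (σ.sc (ρ .la) + σ.sc (ρ .lb))) ∧ τ.steps ≤ σ.steps + 20 * (σ.sc (ρ .la) + σ.sc (ρ .lb)) + 20 := by
  intro τ
  -- the padded length
  set L := (dblF (σ.sc (ρ .la) + σ.sc (ρ .lb) - 1))^[(σ.sc (ρ .la) + σ.sc (ρ .lb) - 1).size] 1 with hL
  obtain ⟨hLpow, hLs, hL2⟩ := dbl_final (σ.sc (ρ .la) + σ.sc (ρ .lb) - 1) (by omega)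
    (t := (σ.sc (ρ .la) + σ.sc (ρ .lb) - 1).size) le_rfl
  rw [← hL] at hLpow hLs hL2
  refine ⟨L, hLpow, hLs, hL2, ?_⟩
  have hAlen : (σ.vi (ν .A)).length = σ.sc (ρ .la) := hla.symm
  have hBlen : (σ.vi (ν .B)).length = σ.sc (ρ .lb) := hlb.symm
  have htakeA : (σ.vi (ν .A)).take (σ.sc (ρ .la)) = σ.vi (ν .A) := by rw [hla, List.take_length]
  have htakeB : (σ.vi (ν .B)).take (σ.sc (ρ .lb)) = σ.vi (ν .B) := by rw [hlb, List.take_length]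
  have hsz : (σ.sc (ρ .la) + σ.sc (ρ .lb) - 1).size ≤ σ.sc (ρ .la) + σ.sc (ρ .lb) - 1 := Nat.size_le.2 (Nat.lt_two_pow_self)
  -- symbolic execution; stage A (five scalar instructions) is kept folded as `X₁`
  have hτ : τ = (pmulPre ρ ν acc : NCom S V O E).eval 𝓔 σ := rfl
  simp only [pmulPre, eval_seq] at hτ
  set X₁ := (sizeOf (ρ .t) (ρ .s) : NCom S V O E).eval 𝓔 ((setc (ρ .L) 1 : NCom S V O E).eval 𝓔
    ((sub (ρ .s) (ρ .s) (ρ .one) : NCom S V O E).eval 𝓔 ((add (ρ .s) (ρ .la) (ρ .lb) : NCom S V O E).eval 𝓔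
    ((setc (ρ .one) 1 : NCom S V O E).eval 𝓔 σ)))) with hX₁
  have xla : X₁.sc (ρ .la) = σ.sc (ρ .la) := by simp [hX₁, eval]
  have xlb : X₁.sc (ρ .lb) = σ.sc (ρ .lb) := by simp [hX₁, eval]
  have xs : X₁.sc (ρ .s) = σ.sc (ρ .la) + σ.sc (ρ .lb) - 1 := by simp [hX₁, eval]
  have xL : X₁.sc (ρ .L) = 1 := by simp [hX₁, eval]
  have xt : X₁.sc (ρ .t) = (σ.sc (ρ .la) + σ.sc (ρ .lb) - 1).size := by simp [hX₁, eval]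
  have xn : X₁.sc (ρ .n) = σ.sc (ρ .n) := by simp [hX₁, eval]
  have xr : ∀ r, (∀ i, r ≠ ρ i) → X₁.sc r = σ.sc r := fun r hr => by simp [hX₁, eval, hr]
  have xvi : X₁.vi = σ.vi := by simp [hX₁, eval]
  have xvo : X₁.vo = σ.vo := by simp [hX₁, eval]
  have xpk : X₁.peak ≤ max σ.peak (σ.sc (ρ .la) + σ.sc (ρ .lb)) := by
    have e : X₁.peak = max (max (max σ.peak 1) (σ.sc (ρ .la) + σ.sc (ρ .lb))) (σ.sc (ρ .la) + σ.sc (ρ .lb) - 1).size := by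
      simp [hX₁, eval]
    rw [e]
    refine max_le (max_le (max_le (le_max_left _ _) (le_max_of_le_right (by omega))) (le_max_right _ _))
      (le_max_of_le_right (by omega))
  have xst : X₁.steps = σ.steps + 5 := by simp [hX₁, eval]
  have hLx : (dblF (X₁.sc (ρ .s)))^[X₁.sc (ρ .t)] (X₁.sc (ρ .L)) = L := by rw [xs, xt, xL, hL]
  rw [dblLoop_eq 𝓔 (ρ .t) (role_ne ρ (show PMulS.L ≠ PMulS.s by decide))] at hτ
  rw [moveN_eq' 𝓔 (ν .A) acc (ρ .x) (ρ .la)] at hτ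
  swap; · simp [xla, xvi, hAlen]
  rw [emitK_eq, emitK_eq] at hτ
  rw [moveN_eq' 𝓔 (ν .B) acc (ρ .x) (ρ .lb)] at hτ
  swap; · simp [eval, xlb, xvi, hBlen]
  have hpk := dblPeak_le 𝓔 (ρ .t) (role_ne ρ (show PMulS.L ≠ PMulS.s by decide)) X₁
  have hst := dblSteps_le 𝓔 (ρ .t) (role_ne ρ (show PMulS.L ≠ PMulS.s by decide)) X₁
  rw [hLx] at hpk
  rw [xt, xst] at hst
  refine ⟨?_, ?_, ?_, ?_, ?_, fun r hr => ?_, ?_, ?_, ?_, ?_, ?_, ?_, fun w hw => ?_, ?_, ?_, ?_⟩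
  · rw [hτ]; simp [eval, hLx]
  · rw [hτ]; simp [eval, xs]
  · rw [hτ]; simp [eval, xn]
  · rw [hτ]; simp [eval, xla]
  · rw [hτ]; simp [eval, xlb]
  · rw [hτ]; simp [eval, hr, xr r hr]
  · rw [hτ]; simp [eval, hLx, xvi, xvo, xla, hacc, hF, htakeA, hAlen]
  · rw [hτ]; simp [eval, hLx, xvi, xvo, xlb, hacc, hG, htakeB, hBlen]
  · rw [hτ]; simp [eval, xvi, xla, hla]
  · rw [hτ]; simp [eval, xvi, xlb, hlb]
  · rw [hτ]; simp [eval, xvi]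
  · rw [hτ]; simp [eval, xvi]
  · rw [hτ]; simp [eval, xvi, hw]
  · rw [hτ]; simp [eval, xvo, hacc]
  · have e : τ.peak = dblPeak 𝓔 (ρ .L) (ρ .s) (ρ .t) X₁ := by rw [hτ]; simp [eval]
    rw [e]
    refine hpk.trans (max_le (xpk.trans (max_le (le_max_left _ _) (le_max_of_le_right (by omega)))) (le_max_of_le_right ?_))
    omega
  · have e : τ.steps = dblSteps 𝓔 (ρ .L) (ρ .s) (ρ .t) X₁ + 3 * σ.sc (ρ .la) + 1 + 1 + 1 + (2 * (L - σ.sc (ρ .la)) + 1) +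
        ((σ.vi (ν .A)).length + (L - σ.sc (ρ .la)) + 1) + (3 * σ.sc (ρ .lb) + 1) + 1 + 1 + (2 * (L - σ.sc (ρ .lb)) + 1) +
        ((σ.vi (ν .B)).length + (L - σ.sc (ρ .lb)) + 1) := by
      rw [hτ]; simp [eval, hLx, xvi, xvo, xla, xlb, hacc, htakeA, htakeB]; omega
    rw [e, hAlen, hBlen]
    omega

/-- The state entering the multiplier call meets the standing precondition. [folklore] -/
theorem pmulPre_mulPre (σ : NState S V O) (hN : 1 < σ.sc (ρ .n)) (hodd : Odd (σ.sc (ρ .n)))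
    (hla : σ.sc (ρ .la) = (σ.vi (ν .A)).length) (hlb : σ.sc (ρ .lb) = (σ.vi (ν .B)).length)
    (ha : 0 < (σ.vi (ν .A)).length) (hb : 0 < (σ.vi (ν .B)).length)
    (hAN : ∀ x ∈ σ.vi (ν .A), x < σ.sc (ρ .n)) (hBN : ∀ x ∈ σ.vi (ν .B), x < σ.sc (ρ .n))
    (hF : σ.vi (ν .F) = []) (hG : σ.vi (ν .G) = []) (hacc : σ.vo acc = []) :
    MulPre ⟨ν .F, ν .G, ν .H, ρ .n, ρ .L⟩ ((pmulPre ρ ν acc : NCom S V O E).eval 𝓔 σ) := by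
  obtain ⟨L, hLpow, hLs, hL2, tL, ts, tn, tla, tlb, tr, tF, tG, tA, tB, tH, tC, tw, tvo, tpk, tst⟩ :=
    pmulPre_facts (𝓔 := 𝓔) ρ ν acc σ hla hlb ha hb hF hG hacc
  have hN0 : 0 < σ.sc (ρ .n) := by omega
  refine ⟨by simpa [tn] using hodd, by simpa [tn] using hN, by simpa [tL] using hLpow, ?_, ?_, ?_, ?_,
    by simp, by simp, by simp⟩
  · simp only [tF, tL, List.length_append, List.length_replicate]; omega
  · simp only [tG, tL, List.length_append, List.length_replicate]; omega
  · intro x hx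
    simp only [tF, tn, List.mem_append, List.mem_replicate] at hx ⊢
    rcases hx with hx | ⟨-, rfl⟩; exacts [hAN x hx, hN0]
  · intro x hx
    simp only [tG, tn, List.mem_append, List.mem_replicate] at hx ⊢
    rcases hx with hx | ⟨-, rfl⟩; exacts [hBN x hx, hN0]

/-- **`pmulP` meets the multiplier's precondition** (its only extension call). [folklore] -/
theorem pmulP_extOK (σ : NState S V O) (hN : 1 < σ.sc (ρ .n)) (hodd : Odd (σ.sc (ρ .n)))
    (hla : σ.sc (ρ .la) = (σ.vi (ν .A)).length) (hlb : σ.sc (ρ .lb) = (σ.vi (ν .B)).length)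
    (ha : 0 < (σ.vi (ν .A)).length) (hb : 0 < (σ.vi (ν .B)).length)
    (hAN : ∀ x ∈ σ.vi (ν .A), x < σ.sc (ρ .n)) (hBN : ∀ x ∈ σ.vi (ν .B), x < σ.sc (ρ .n))
    (hF : σ.vi (ν .F) = []) (hG : σ.vi (ν .G) = []) (hacc : σ.vo acc = []) :
    (pmulP M ρ ν acc : NCom S V O E).extOK 𝓔 σ := by
  refine ⟨extOK_of_noExt 𝓔 (pmulPre_noExt ρ ν acc).1 σ, ?_, extOK_of_noExt 𝓔 (pmulPre_noExt ρ ν acc).2 _⟩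
  exact M.pre_of _ _ (pmulPre_mulPre (𝓔 := 𝓔) ρ ν acc σ hN hodd hla hlb ha hb hAN hBN hF hG hacc)

/-- **Specification of `pmulP`**: `C := mulCoeffs N A B`, `A, B` consumed, the scratch queues
and the accumulator clean again, the scalars `n, la, lb` unchanged, frame; `peak ≤ max peak
(max N (2 (|A|+|B|)))`; `steps ≤ steps + 30 (|A| + |B|) + cost (2 (|A| + |B|)) + 30`.
[Harvey 2021, §2.2, Lemma 2.1] [folklore] -/
theorem pmulP_spec (σ : NState S V O) (hN : 1 < σ.sc (ρ .n))
    (hla : σ.sc (ρ .la) = (σ.vi (ν .A)).length) (hlb : σ.sc (ρ .lb) = (σ.vi (ν .B)).length)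
    (ha : 0 < (σ.vi (ν .A)).length) (hb : 0 < (σ.vi (ν .B)).length)
    (hBN : ∀ x ∈ σ.vi (ν .B), x < σ.sc (ρ .n))
    (hF : σ.vi (ν .F) = []) (hG : σ.vi (ν .G) = []) (hC : σ.vi (ν .C) = []) (hacc : σ.vo acc = []) :
    let τ := (pmulP M ρ ν acc : NCom S V O E).eval 𝓔 σ
    τ.vi (ν .C) = mulCoeffs (σ.sc (ρ .n)) (σ.vi (ν .A)) (σ.vi (ν .B)) ∧
      τ.vi (ν .A) = [] ∧ τ.vi (ν .B) = [] ∧ τ.vi (ν .F) = [] ∧ τ.vi (ν .G) = [] ∧ τ.vi (ν .H) = [] ∧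
      (∀ w, (∀ i, w ≠ ν i) → τ.vi w = σ.vi w) ∧ τ.vo = σ.vo ∧
      τ.sc (ρ .n) = σ.sc (ρ .n) ∧ τ.sc (ρ .la) = σ.sc (ρ .la) ∧ τ.sc (ρ .lb) = σ.sc (ρ .lb) ∧
      (∀ r, (∀ i, r ≠ ρ i) → τ.sc r = σ.sc r) ∧
      τ.peak ≤ max σ.peak (max (σ.sc (ρ .n)) (2 * (σ.sc (ρ .la) + σ.sc (ρ .lb)))) ∧
      τ.steps ≤ σ.steps + 30 * (σ.sc (ρ .la) + σ.sc (ρ .lb)) + M.cost (2 * (σ.sc (ρ .la) + σ.sc (ρ .lb))) + 30 := by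
  intro τ
  obtain ⟨L, hLpow, hLs, hL2, tL, ts, tn, tla, tlb, tr, tF, tG, tA, tB, tH, tC, tw, tvo, tpk, tst⟩ :=
    pmulPre_facts (𝓔 := 𝓔) ρ ν acc σ hla hlb ha hb hF hG hacc
  set τ₁ := (pmulPre ρ ν acc : NCom S V O E).eval 𝓔 σ with hτ₁
  -- the product computed by the opcode
  have hprod : negMul (σ.sc (ρ .n)) L (σ.vi (ν .A) ++ List.replicate (L - (σ.vi (ν .A)).length) 0)
      (σ.vi (ν .B) ++ List.replicate (L - (σ.vi (ν .B)).length) 0) =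
      mulCoeffs (σ.sc (ρ .n)) (σ.vi (ν .A)) (σ.vi (ν .B)) ++ List.replicate (L - (σ.sc (ρ .la) + σ.sc (ρ .lb) - 1)) 0 := by
    rw [negMul_pad hN ha hb hBN (by rw [← hla, ← hlb]; exact hLs), ← hla, ← hlb]
  have hs : σ.sc (ρ .la) + σ.sc (ρ .lb) - 1 = (mulCoeffs (σ.sc (ρ .n)) (σ.vi (ν .A)) (σ.vi (ν .B))).length := by
    rw [length_mulCoeffs, hla, hlb]
  have hmax : (mulCoeffs (σ.sc (ρ .n)) (σ.vi (ν .A)) (σ.vi (ν .B)) ++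
      List.replicate (L - (σ.sc (ρ .la) + σ.sc (ρ .lb) - 1)) 0).foldr max 0 ≤ σ.sc (ρ .n) := by
    refine foldr_max_le fun x hx => ?_
    rcases List.mem_append.1 hx with hx | hx
    · exact (lt_of_mem_mulCoeffs hN hx).le
    · rw [(List.mem_replicate.1 hx).2]; exact Nat.zero_le _
  -- symbolic execution of the call and the finish
  have hτ : τ = (pmulPost ρ ν acc : NCom S V O E).eval 𝓔 ((ext (M.mulOp ⟨ν .F, ν .G, ν .H, ρ .n, ρ .L⟩) : NCom S V O E).eval 𝓔 τ₁) := rfl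
  have hext : ((ext (M.mulOp ⟨ν .F, ν .G, ν .H, ρ .n, ρ .L⟩) : NCom S V O E).eval 𝓔 τ₁) =
      negMulSem M.cost ⟨ν .F, ν .G, ν .H, ρ .n, ρ .L⟩ τ₁ := M.sem_eq _ _
  rw [hext] at hτ
  simp only [negMulSem, tF, tG, tn, tL, hprod, pmulPost, eval_seq] at hτ
  rw [moveN_eq' 𝓔 (ν .H) acc (ρ .x) (ρ .s)] at hτ
  swap
  · simp only [NState.sc_bump, NState.sc_setVi, NState.vi_bump, NState.vi_setVi, Function.update_self, ts, List.length_append,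
      List.length_replicate]; omega
  have htake : (mulCoeffs (σ.sc (ρ .n)) (σ.vi (ν .A)) (σ.vi (ν .B)) ++
      List.replicate (L - (σ.sc (ρ .la) + σ.sc (ρ .lb) - 1)) 0).take (σ.sc (ρ .la) + σ.sc (ρ .lb) - 1) =
      mulCoeffs (σ.sc (ρ .n)) (σ.vi (ν .A)) (σ.vi (ν .B)) := by
    rw [hs, List.take_left]
  refine ⟨?_, ?_, ?_, ?_, ?_, ?_, fun w hw => ?_, ?_, ?_, ?_, ?_, fun r hr => ?_, ?_, ?_⟩
  · rw [hτ]; simp [eval, ts, htake, tvo, hacc, tC, hC]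
  · rw [hτ]; simp [eval, tA]
  · rw [hτ]; simp [eval, tB]
  · rw [hτ]; simp [eval]
  · rw [hτ]; simp [eval]
  · rw [hτ]; simp [eval]
  · rw [hτ]; simp [eval, hw, tw w hw]
  · rw [hτ]; simp [eval, tvo, hacc]
  · rw [hτ]; simp [eval, tn]
  · rw [hτ]; simp [eval, tla]
  · rw [hτ]; simp [eval, tlb]
  · rw [hτ]; simp [eval, hr, tr r hr]
  · have e : τ.peak = max τ₁.peak ((mulCoeffs (σ.sc (ρ .n)) (σ.vi (ν .A)) (σ.vi (ν .B)) ++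
        List.replicate (L - (σ.sc (ρ .la) + σ.sc (ρ .lb) - 1)) 0).foldr max 0) := by
      rw [hτ]; simp [eval]
    rw [e]
    exact max_le (tpk.trans (max_le (le_max_left _ _) (le_max_of_le_right (le_max_right _ _))))
      (le_max_of_le_right (le_max_of_le_left hmax))
  · have e : τ.steps = τ₁.steps + (M.cost L + 1) + (3 * (σ.sc (ρ .la) + σ.sc (ρ .lb) - 1) + 1) +
        ((mulCoeffs (σ.sc (ρ .n)) (σ.vi (ν .A)) (σ.vi (ν .B))).length + 1) +
        (L - (σ.sc (ρ .la) + σ.sc (ρ .lb) - 1) + 1) + (L + 1) + (L + 1) := by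
      have hFlen : (τ₁.vi (ν .F)).length = L := by rw [tF, List.length_append, List.length_replicate]; omega
      have hGlen : (τ₁.vi (ν .G)).length = L := by rw [tG, List.length_append, List.length_replicate]; omega
      rw [hτ]; simp [eval, ts, tvo, hacc, hla, hlb, hFlen, hGlen]; omega
    have hcost : M.cost L ≤ M.cost (2 * (σ.sc (ρ .la) + σ.sc (ρ .lb))) := M.cost_mono (by omega)
    rw [e, length_mulCoeffs, ← hla, ← hlb]
    omega

end PMul

end NCom

end Literature.Computability.Complexity
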